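import Summits.AnomalousDissipation.AnomalousDissipation.Theorems.TwoAndHalfDScalarLift2halfDRGalerkinDeriv

/-!
# Route TwoAndHalfD (AnomalousDissipation) — the planar section of an `x₃`-invariant
# Hopf–Galerkin scheme is a planar Hopf–Galerkin scheme (support of item `ScalarLift2halfDR`,
# stmt-AnomalousDissipation-14983)

Helper file (everything proved). For an `x₃`-invariant Hopf–Galerkin scheme `(N, F, U)` on `𝕋³`
(`Literature.Analysis.FluidPDE.IsHopfGalerkinScheme`, as produced by
`exists_isHopfGalerkinScheme_invariant`) with `2½`-dimensional datum `(a, b)∘π` and steady force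
`(g, h)∘π`:

* `planar_energy_eq` — the exact energy identity of the planar sections
  `V n t = (U n t)₍₀,₁₎(·, ·, 0)`: `½‖V n t‖² + ν∫ₛᵗ‖∇V n‖₂² = ½‖V n s‖² + ∫ₛᵗ⟪G n, V n⟫`. Proof by
  differentiation: `E(t) = ⟪U n t, (V t₀, 0)∘π⟫ - E(t₀) + ½‖V t - V t₀‖²`, the pairing with the lifted
  Galerkin mode being differentiated by the Galerkin equations (its right-hand side descends to
  `𝕋²`), while `0 ≤ ‖V t - V t₀‖² ≤ ‖U n t - U n t₀‖²` vanishes to second order at `t₀`; then the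
  fundamental theorem of calculus;
* `isHopfGalerkinScheme_planar` — the planar sections form a Hopf–Galerkin scheme on `𝕋²` for the
  data `(ν, g, a)` (every clause descends; Galerkin equations against a planar mode `a` are the
  three-dimensional ones against `(a, 0)∘π`);
* `limitField_planar` — the planar section of an invariant limit field is a limit field of the
  planar scheme (measurable lift, `L²` slices, coefficientwise convergence), ready for
  `IsHopfGalerkinScheme.isLerayHopfOn_limit` in dimension two.

References: Hopf 1951 §§2–4; Robinson–Rodrigo–Sadowski 2016, Thm. 4.4; Majda–Bertozzi 2002, §2.3.1;
Bruè–De Lellis 2023, §3.1.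
-/

noncomputable section

open MeasureTheory Set Filter Topology Function UnitAddTorus
open scoped ENNReal NNReal InnerProductSpace
open Literature.Analysis.FunctionSpaces Literature.Analysis.FunctionSpaces.Torus
open Literature.Analysis.FluidPDE Literature.Analysis.FluidPDE.Torus

namespace Summit.AnomalousDissipation.AnomalousDissipation.Theorems

-- D-0017: single-problem summit ⇒ `Summit.AnomalousDissipation.AnomalousDissipation.…` by design.
set_option linter.dupNamespace false

/-! ## The planar energy identity of an invariant scheme -/

section PlanarEnergy

variable {ν : ℝ} {f₃ : ℝ → (UnitAddTorus (Fin 3)) → (EuclideanSpace ℝ (Fin 3))} {u₃ : (UnitAddTorus (Fin 3)) → (EuclideanSpace ℝ (Fin 3))} {N : ℕ → ℕ} {F U : ℕ → ℝ → (UnitAddTorus (Fin 3)) → (EuclideanSpace ℝ (Fin 3))}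

/-- **The exact energy identity of the planar sections of an `x₃`-invariant Hopf–Galerkin
scheme**: with `V n t = (U n t)₍₀,₁₎(·, 0)` and `G n t` the planar section of `F n t`,
`½‖V n t‖² + ν∫ₛᵗ‖∇V n‖₂² = ½‖V n s‖² + ∫ₛᵗ⟪G n, V n⟫` on `0 ≤ s ≤ t`. Proof: `E(t) = ½‖V t‖²` is
continuous on `[0, ∞)` and differentiable at every `t₀ > 0` with derivative
`-ν‖∇V t₀‖₂² + ⟪G t₀, V t₀⟫`, by writing `E(t) = ⟪U n t, (V t₀, 0)∘π⟫ - E(t₀) + ½‖V t - V t₀‖²`: the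
pairing with the (lifted) Galerkin mode `(V t₀, 0)∘π` is differentiated by the Galerkin equations
and its right-hand side descends to `T²`, while `0 ≤ ‖V t - V t₀‖² ≤ ‖U n t - U n t₀‖²` vanishes to
second order at `t₀` (`schemeSqDist_hasDerivAt_zero`); then the fundamental theorem of calculus. [folklore] -/
theorem planar_energy_eq (hS : IsHopfGalerkinScheme ν f₃ u₃ N F U)
    (hUinv : ∀ n (t : ℝ) (s : UnitAddCircle) (x : (UnitAddTorus (Fin 3))), U n t (x + Pi.single (Fin.last 2) s) = U n t x)
    (hFinv : ∀ n (t : ℝ) (s : UnitAddCircle) (x : (UnitAddTorus (Fin 3))), F n t (x + Pi.single (Fin.last 2) s) = F n t x)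
    (n : ℕ) (s t : ℝ) (hs : 0 ≤ s) (hst : s ≤ t) :
    kineticEnergy (fun y => planarProjE (U n t (planarSect y))) +
        ν * (∫⁻ τ in Ioo s t, eGradNormSq (fun y => planarProjE (U n τ (planarSect y)))).toReal =
      kineticEnergy (fun y => planarProjE (U n s (planarSect y))) +
        ∫ τ in s..t, ∫ y, ⟪planarProjE (F n τ (planarSect y)), planarProjE (U n τ (planarSect y))⟫_ℝ := by
  -- ### abbreviations and the `2½`-dimensional structure of the slices
  set V : ℝ → (UnitAddTorus (Fin 2)) → (EuclideanSpace ℝ (Fin 2)) := fun τ y => planarProjE (U n τ (planarSect y)) with hVdef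
  set Rv : ℝ → (UnitAddTorus (Fin 2)) → ℝ := fun τ y => U n τ (planarSect y) 2 with hRvdef
  set G : ℝ → (UnitAddTorus (Fin 2)) → (EuclideanSpace ℝ (Fin 2)) := fun τ y => planarProjE (F n τ (planarSect y)) with hGdef
  set Hs : ℝ → (UnitAddTorus (Fin 2)) → ℝ := fun τ y => F n τ (planarSect y) 2 with hHsdef
  have hUeq : ∀ τ, U n τ = twoHalf (V τ) (Rv τ) := fun τ => eq_twoHalf_of_forall_add_single (hUinv n τ)
  have hFeq : ∀ τ, F n τ = twoHalf (G τ) (Hs τ) := fun τ => eq_twoHalf_of_forall_add_single (hFinv n τ)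
  have hmode : ∀ τ, 0 ≤ τ → IsGalerkinMode (N n) (V τ) := fun τ hτ =>
    isGalerkinMode_left_of_twoHalf (by rw [← hUeq τ]; exact hS.isGalerkinMode n τ hτ)
  have hVs : ∀ τ, 0 ≤ τ → IsSmooth (V τ) := fun τ hτ => (hmode τ hτ).isSmooth
  have hRs : ∀ τ, 0 ≤ τ → IsSmooth (Rv τ) := fun τ hτ =>
    isSmooth_right_of_twoHalf (by rw [← hUeq τ]; exact (hS.isGalerkinMode n τ hτ).isSmooth)
  have hGc : ∀ τ, 0 ≤ τ → Continuous (G τ) := fun τ hτ =>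
    planarProjE.continuous.comp ((hS.continuous_force_slice n hτ).comp continuous_planarSect)
  have hHc : ∀ τ, 0 ≤ τ → Continuous (Hs τ) := fun τ hτ =>
    (EuclideanSpace.proj (2 : Fin 3) : (EuclideanSpace ℝ (Fin 3)) →L[ℝ] ℝ).continuous.comp
      ((hS.continuous_force_slice n hτ).comp continuous_planarSect)
  have hVst : ContinuousOn (stLift V) (Ici 0 ×ˢ univ) := continuousOn_stLift_planarPart (hS.continuousOn n)
  have hGst : ContinuousOn (stLift G) (Ici 0 ×ˢ univ) := continuousOn_stLift_planarPart (hS.continuousOn_force n)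
  -- ### the planar dissipation and work are continuous in time
  have hDc : ContinuousOn (fun τ => (eGradNormSq (V τ)).toReal) (Ici 0) :=
    continuousOn_toReal_eGradNormSq_of_band_limited hVst fun τ hτ _ hk => (hmode τ hτ).mFourierCoeff_eq_zero hk
  have hDfin : ∀ τ, 0 ≤ τ → eGradNormSq (V τ) ≠ ⊤ := fun τ hτ => (eGradNormSq_lt_top (hVs τ hτ)).ne
  have hWc : ContinuousOn (fun τ => ∫ y, ⟪G τ y, V τ y⟫_ℝ) (Ici 0) :=
    continuousOn_integral_inner_of_continuousOn_stLift hGst hVst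
  -- ### the energy and its derivative
  set E : ℝ → ℝ := fun τ => kineticEnergy (V τ) with hEdef
  set e : ℝ → ℝ := fun τ => -(ν * (eGradNormSq (V τ)).toReal) + ∫ y, ⟪G τ y, V τ y⟫_ℝ with hedef
  have hEc : ContinuousOn E (Ici 0) :=
    continuousOn_const.mul (continuousOn_integral_norm_sq_of_continuousOn_stLift hVst)
  have hec : ContinuousOn e (Ici 0) := ((continuousOn_const.mul hDc).neg).add hWc
  have hderiv : ∀ t₀, 0 < t₀ → HasDerivAt E (e t₀) t₀ := by
    intro t₀ ht₀
    have ht₀' : (0 : ℝ) ≤ t₀ := ht₀.le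
    -- the pairing with the lifted mode `(V t₀, 0)∘π`
    have hA : IsGalerkinMode (N n) (twoHalf (V t₀) 0) := isGalerkinMode_twoHalf_zero (hmode t₀ ht₀')
    have hP := hS.hasDerivAt_galerkin_pairing n hA ht₀
    have hRHS : ∫ x, (⟪U n t₀ x, Torus.convect (U n t₀) (twoHalf (V t₀) 0) x⟫_ℝ +
        ν * ⟪U n t₀ x, Torus.laplacian (twoHalf (V t₀) 0) x⟫_ℝ + ⟪F n t₀ x, twoHalf (V t₀) 0 x⟫_ℝ) = e t₀ := by
      rw [hUeq t₀, hFeq t₀, galerkin_rhs_twoHalf_planar (hVs t₀ ht₀') (hRs t₀ ht₀') (hGc t₀ ht₀') (hHc t₀ ht₀')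
        (hVs t₀ ht₀') ν, integral_galerkin_rhs_self (hVs t₀ ht₀') (hmode t₀ ht₀').isDivFree (hGc t₀ ht₀') ν]
    -- the squared distance to the slice at `t₀` vanishes to second order
    have hc₀ : Continuous (V t₀) := (hVs t₀ ht₀').continuous
    have hD : HasDerivAt (fun τ => ∫ y, ‖V τ y - V t₀ y‖ ^ 2) 0 t₀ := by
      refine hasDerivAt_zero_of_squeeze (Eventually.of_forall fun τ => integral_nonneg fun y => sq_nonneg _)
        ?_ ?_ ?_ (schemeSqDist_hasDerivAt_zero hS n ht₀)
      · filter_upwards [Ioi_mem_nhds ht₀] with τ hτ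
        have hτ' : (0 : ℝ) ≤ τ := le_of_lt hτ
        have hpt : ∀ x, U n τ x - U n t₀ x = twoHalf (V τ - V t₀) (Rv τ - Rv t₀) x := fun x => by
          rw [twoHalf_sub, hUeq τ, hUeq t₀]; rfl
        simp_rw [hpt]
        have hVm : MemLp (V τ - V t₀) 2 volume := ((hVs τ hτ').sub (hVs t₀ ht₀')).memLp 2
        have hRm : MemLp (Rv τ - Rv t₀) 2 volume := ((hRs τ hτ').sub (hRs t₀ ht₀')).memLp 2
        rw [integral_norm_sq_twoHalf_of_memLp hVm hRm]
        have h2 : 0 ≤ ∫ y, (Rv τ - Rv t₀) y ^ 2 := integral_nonneg fun y => sq_nonneg _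
        have h1 : ∫ y, ‖V τ y - V t₀ y‖ ^ 2 = ∫ y, ‖(V τ - V t₀) y‖ ^ 2 := rfl
        linarith
      · simp
      · simp
    -- the expansion `E τ = ⟪U n τ, (V t₀,0)∘π⟫ - E t₀ + ½‖V τ - V t₀‖²` for `τ > 0`
    have hexp : E =ᶠ[𝓝 t₀] fun τ =>
        (∫ x, ⟪U n τ x, twoHalf (V t₀) 0 x⟫_ℝ) - E t₀ + 2⁻¹ * ∫ y, ‖V τ y - V t₀ y‖ ^ 2 := by
      filter_upwards [Ioi_mem_nhds ht₀] with τ hτ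
      have hτ' : (0 : ℝ) ≤ τ := le_of_lt hτ
      have hcτ : Continuous (V τ) := (hVs τ hτ').continuous
      rw [hUeq τ, integral_inner_twoHalf_twoHalf_zero hcτ (Rv τ) hc₀]
      have i1 : Integrable (fun y => ‖V τ y‖ ^ 2) volume := (hcτ.norm.pow 2).integrable_unitAddTorus
      have i2 : Integrable (fun y => 2 * ⟪V τ y, V t₀ y⟫_ℝ) volume :=
        ((hcτ.inner hc₀).integrable_unitAddTorus).const_mul 2
      have i3 : Integrable (fun y => ‖V t₀ y‖ ^ 2) volume := (hc₀.norm.pow 2).integrable_unitAddTorus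
      have i12 : Integrable (fun y => ‖V τ y‖ ^ 2 - 2 * ⟪V τ y, V t₀ y⟫_ℝ) volume := i1.sub i2
      have hpt : (fun y => ‖V τ y - V t₀ y‖ ^ 2) =
          fun y => ‖V τ y‖ ^ 2 - 2 * ⟪V τ y, V t₀ y⟫_ℝ + ‖V t₀ y‖ ^ 2 := by
        funext y
        rw [norm_sub_sq_real]
      simp only [hEdef, kineticEnergy]
      rw [hpt, integral_add i12 i3, integral_sub i1 i2, integral_const_mul]
      ring
    have hd := (hP.sub_const (E t₀)).add (hD.const_mul 2⁻¹)
    rw [hRHS, mul_zero, add_zero] at hd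
    exact hd.congr_of_eventuallyEq hexp
  -- ### the fundamental theorem of calculus on `[s, t]`
  have hIcc : Icc s t ⊆ Ici 0 := fun τ hτ => mem_Ici.2 (hs.trans hτ.1)
  have hFTC := intervalIntegral.integral_eq_sub_of_hasDerivAt_of_le hst (hEc.mono hIcc)
    (fun τ hτ => hderiv τ (hs.trans_lt hτ.1)) ((hec.mono hIcc).intervalIntegrable_of_Icc hst)
  have hI : ∀ {φ : ℝ → ℝ}, ContinuousOn φ (Ici 0) → IntervalIntegrable φ volume s t :=
    fun hφ => (hφ.mono hIcc).intervalIntegrable_of_Icc hst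
  have iD : IntervalIntegrable (fun τ => -(ν * (eGradNormSq (V τ)).toReal)) volume s t :=
    hI (φ := fun τ => -(ν * (eGradNormSq (V τ)).toReal)) ((continuousOn_const.mul hDc).neg)
  have hsplit : ∫ τ in s..t, e τ =
      -(ν * ∫ τ in s..t, (eGradNormSq (V τ)).toReal) + ∫ τ in s..t, ∫ y, ⟪G τ y, V τ y⟫_ℝ := by
    simp only [hedef]
    rw [intervalIntegral.integral_add iD (hI hWc), intervalIntegral.integral_neg, intervalIntegral.integral_const_mul]
  rw [toReal_setLIntegral_eq_intervalIntegral (D := fun τ => eGradNormSq (V τ)) hst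
    (fun τ hτ => hDfin τ (hs.trans hτ.1)) (hDc.mono hIcc)]
  change E t + ν * ∫ τ in s..t, (eGradNormSq (V τ)).toReal = E s + ∫ τ in s..t, ∫ y, ⟪G τ y, V τ y⟫_ℝ
  linarith [hFTC, hsplit]

end PlanarEnergy

/-! ## The planar section of an invariant scheme is a planar scheme -/

section PlanarScheme

variable {ν : ℝ} {g : (UnitAddTorus (Fin 2)) → (EuclideanSpace ℝ (Fin 2))} {h : (UnitAddTorus (Fin 2)) → ℝ} {a : (UnitAddTorus (Fin 2)) → (EuclideanSpace ℝ (Fin 2))} {b : (UnitAddTorus (Fin 2)) → ℝ}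
  {N : ℕ → ℕ} {F U : ℕ → ℝ → (UnitAddTorus (Fin 3)) → (EuclideanSpace ℝ (Fin 3))}

/-- **The planar section of an `x₃`-invariant Hopf–Galerkin scheme on `T³` with
`2½`-dimensional data is a Hopf–Galerkin scheme on `T²`** for the planar data: orders, smoothed
forces and approximations are the planar parts of the planar sections; every clause descends
(Galerkin equations tested against a planar mode `a` are the three-dimensional ones tested against
the lifted mode `(a, 0)∘π`; the energy identity is `planar_energy_eq`). [folklore] -/
theorem isHopfGalerkinScheme_planar (hS : IsHopfGalerkinScheme ν (fun _ => twoHalf g h) (twoHalf a b) N F U)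
    (hUinv : ∀ n (t : ℝ) (s : UnitAddCircle) (x : (UnitAddTorus (Fin 3))), U n t (x + Pi.single (Fin.last 2) s) = U n t x)
    (hFinv : ∀ n (t : ℝ) (s : UnitAddCircle) (x : (UnitAddTorus (Fin 3))), F n t (x + Pi.single (Fin.last 2) s) = F n t x)
    (ha : MemLp a 2 volume) :
    IsHopfGalerkinScheme ν (fun _ => g) a N (fun n t y => planarProjE (F n t (planarSect y)))
      (fun n t y => planarProjE (U n t (planarSect y))) := by
  set V : ℕ → ℝ → (UnitAddTorus (Fin 2)) → (EuclideanSpace ℝ (Fin 2)) := fun n t y => planarProjE (U n t (planarSect y)) with hVdef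
  set Rv : ℕ → ℝ → (UnitAddTorus (Fin 2)) → ℝ := fun n t y => U n t (planarSect y) 2 with hRvdef
  set G : ℕ → ℝ → (UnitAddTorus (Fin 2)) → (EuclideanSpace ℝ (Fin 2)) := fun n t y => planarProjE (F n t (planarSect y)) with hGdef
  set Hs : ℕ → ℝ → (UnitAddTorus (Fin 2)) → ℝ := fun n t y => F n t (planarSect y) 2 with hHsdef
  have hUeq : ∀ n τ, U n τ = twoHalf (V n τ) (Rv n τ) := fun n τ => eq_twoHalf_of_forall_add_single (hUinv n τ)
  have hFeq : ∀ n τ, F n τ = twoHalf (G n τ) (Hs n τ) := fun n τ => eq_twoHalf_of_forall_add_single (hFinv n τ)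
  have hmode : ∀ n τ, 0 ≤ τ → IsGalerkinMode (N n) (V n τ) := fun n τ hτ =>
    isGalerkinMode_left_of_twoHalf (by rw [← hUeq n τ]; exact hS.isGalerkinMode n τ hτ)
  have hVs : ∀ n τ, 0 ≤ τ → IsSmooth (V n τ) := fun n τ hτ => (hmode n τ hτ).isSmooth
  have hRs : ∀ n τ, 0 ≤ τ → IsSmooth (Rv n τ) := fun n τ hτ =>
    isSmooth_right_of_twoHalf (by rw [← hUeq n τ]; exact (hS.isGalerkinMode n τ hτ).isSmooth)
  have hGc : ∀ n τ, 0 ≤ τ → Continuous (G n τ) := fun n τ hτ =>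
    planarProjE.continuous.comp ((hS.continuous_force_slice n hτ).comp continuous_planarSect)
  have hHc : ∀ n τ, 0 ≤ τ → Continuous (Hs n τ) := fun n τ hτ =>
    (EuclideanSpace.proj (2 : Fin 3) : (EuclideanSpace ℝ (Fin 3)) →L[ℝ] ℝ).continuous.comp
      ((hS.continuous_force_slice n hτ).comp continuous_planarSect)
  have hgF : ∀ n τ, (fun x => F n τ x - twoHalf g h x) = twoHalf (G n τ - g) (Hs n τ - h) := fun n τ => by
    rw [twoHalf_sub, ← hFeq n τ]; rfl
  exact
  { tendsto_order := hS.tendsto_order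
    smooth_force := fun n => contDiff_stLift_planarPart (hS.smooth_force n)
    tendsto_force := fun T hT => by
      refine tendsto_of_tendsto_of_tendsto_of_le_of_le tendsto_const_nhds (hS.tendsto_force T hT)
        (fun _ => zero_le) fun n => lintegral_mono fun τ => ?_
      calc ∫⁻ y, ‖G n τ y - g y‖ₑ ^ 2 = ∫⁻ y, ‖(G n τ - g) y‖ₑ ^ 2 := rfl
        _ ≤ ∫⁻ x, ‖twoHalf (G n τ - g) (Hs n τ - h) x‖ₑ ^ 2 := lintegral_enorm_sq_left_le_twoHalf _ _
        _ = ∫⁻ x, ‖F n τ x - twoHalf g h x‖ₑ ^ 2 := by rw [← hgF n τ]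
    continuousOn := fun n => continuousOn_stLift_planarPart (hS.continuousOn n)
    isGalerkinMode := fun n t ht => hmode n t ht
    isWeaklyDivFree := fun n t ht => isWeaklyDivFree_of_twoHalf ((hVs n t ht).memLp 2)
      (by rw [← hUeq n t]; exact hS.isWeaklyDivFree n t ht)
    galerkin := fun n a₂ ha₂ s t hs hst => by
      have h3 := hS.galerkin n (twoHalf a₂ 0) (isGalerkinMode_twoHalf_zero ha₂) s t hs hst
      have hac : Continuous a₂ := ha₂.isSmooth.continuous
      rw [hUeq n t, hUeq n s, integral_inner_twoHalf_twoHalf_zero (hVs n t (hs.trans hst)).continuous _ hac,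
        integral_inner_twoHalf_twoHalf_zero (hVs n s hs).continuous _ hac] at h3
      rw [h3]
      refine intervalIntegral.integral_congr fun τ hτ => ?_
      rw [uIcc_of_le hst] at hτ
      have hτ0 : 0 ≤ τ := hs.trans hτ.1
      rw [hUeq n τ, hFeq n τ]
      exact galerkin_rhs_twoHalf_planar (hVs n τ hτ0) (hRs n τ hτ0) (hGc n τ hτ0) (hHc n τ hτ0) ha₂.isSmooth ν
    energy_eq := fun n s t hs hst => planar_energy_eq hS hUinv hFinv n s t hs hst
    initial_inner := fun n a₂ ha₂ => by
      have h3 := hS.initial_inner n (twoHalf a₂ 0) (isGalerkinMode_twoHalf_zero ha₂)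
      rwa [hUeq n 0, integral_inner_twoHalf_twoHalf_zero (hVs n 0 le_rfl).continuous _ ha₂.isSmooth.continuous,
        integral_inner_twoHalf_planar ha (ha₂.isSmooth.memLp 2) b] at h3
    tendsto_initial := by
      refine tendsto_of_tendsto_of_tendsto_of_le_of_le tendsto_const_nhds hS.tendsto_initial
        (fun _ => zero_le) fun n => ?_
      have heq : U n 0 - twoHalf a b = twoHalf (V n 0 - a) (Rv n 0 - b) := by rw [twoHalf_sub, ← hUeq n 0]
      calc eLpNorm (V n 0 - a) 2 volume ≤ eLpNorm (twoHalf (V n 0 - a) (Rv n 0 - b)) 2 volume :=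
            eLpNorm_left_le_twoHalf (((hVs n 0 le_rfl).continuous.aestronglyMeasurable).sub ha.1) _ _
        _ = eLpNorm (U n 0 - twoHalf a b) 2 volume := by rw [heq] }

/-- **The planar section of the invariant limit field is a limit field of the planar scheme**:
measurability of the lift, `L²` slices and coefficientwise convergence descend from `T³` to `T²`
(the coefficient of the planar part at `k` is the planar part of the coefficient at `(k, 0)`). [folklore] -/
theorem limitField_planar {u : ℝ → (UnitAddTorus (Fin 3)) → (EuclideanSpace ℝ (Fin 3))}
    (hUinv : ∀ n (t : ℝ) (s : UnitAddCircle) (x : (UnitAddTorus (Fin 3))), U n t (x + Pi.single (Fin.last 2) s) = U n t x)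
    (huinv : ∀ (t : ℝ) (s : UnitAddCircle) (x : (UnitAddTorus (Fin 3))), u t (x + Pi.single (Fin.last 2) s) = u t x)
    (hUc : ∀ n t, 0 ≤ t → Continuous (U n t))
    (hum : AEStronglyMeasurable (stLift u) (volume.restrict (Ioi 0 ×ˢ univ)))
    (hu : ∀ t, 0 ≤ t → MemLp (u t) 2 volume)
    (hc : ∀ t, 0 ≤ t → ∀ K, Tendsto (fun n => mFourierCoeff (EuclideanSpace.complexify ∘ U n t) K)
      atTop (𝓝 (mFourierCoeff (EuclideanSpace.complexify ∘ u t) K))) :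
    AEStronglyMeasurable (stLift fun t y => planarProjE (u t (planarSect y))) (volume.restrict (Ioi 0 ×ˢ univ)) ∧
      (∀ t, 0 ≤ t → MemLp (fun y => planarProjE (u t (planarSect y))) 2 volume) ∧
      ∀ t, 0 ≤ t → ∀ k, Tendsto
        (fun n => mFourierCoeff (EuclideanSpace.complexify ∘ fun y => planarProjE (U n t (planarSect y))) k) atTop
        (𝓝 (mFourierCoeff (EuclideanSpace.complexify ∘ fun y => planarProjE (u t (planarSect y))) k)) := by
  set Vu : ℝ → (UnitAddTorus (Fin 2)) → (EuclideanSpace ℝ (Fin 2)) := fun t y => planarProjE (u t (planarSect y)) with hVudef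
  set Ru : ℝ → (UnitAddTorus (Fin 2)) → ℝ := fun t y => u t (planarSect y) 2 with hRudef
  set V : ℕ → ℝ → (UnitAddTorus (Fin 2)) → (EuclideanSpace ℝ (Fin 2)) := fun n t y => planarProjE (U n t (planarSect y)) with hVdef
  set Rv : ℕ → ℝ → (UnitAddTorus (Fin 2)) → ℝ := fun n t y => U n t (planarSect y) 2 with hRvdef
  have hueq : ∀ t, u t = twoHalf (Vu t) (Ru t) := fun t => eq_twoHalf_of_forall_add_single (huinv t)
  have hUeq : ∀ n t, U n t = twoHalf (V n t) (Rv n t) := fun n t => eq_twoHalf_of_forall_add_single (hUinv n t)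
  have hufun : u = fun t => twoHalf (Vu t) (Ru t) := funext hueq
  refine ⟨?_, fun t ht => ?_, fun t ht k => ?_⟩
  · rw [hufun] at hum
    exact (aestronglyMeasurable_stLift_of_twoHalf hum).1
  · have h2 := hu t ht
    rw [hueq t] at h2
    exact (memLp_of_twoHalf h2).1
  · -- integrability of the sections
    have h2 := hu t ht
    rw [hueq t] at h2
    obtain ⟨hVm, hRm⟩ := memLp_of_twoHalf h2
    have hVi : Integrable (Vu t) volume := hVm.integrable one_le_two
    have hRi : Integrable (Ru t) volume := hRm.integrable one_le_two
    have hVni : ∀ n, Integrable (V n t) volume := fun n =>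
      (planarProjE.continuous.comp ((hUc n t ht).comp continuous_planarSect)).integrable_unitAddTorus
    have hRni : ∀ n, Integrable (Rv n t) volume := fun n =>
      ((EuclideanSpace.proj (2 : Fin 3) : (EuclideanSpace ℝ (Fin 3)) →L[ℝ] ℝ).continuous.comp
        ((hUc n t ht).comp continuous_planarSect)).integrable_unitAddTorus
    -- componentwise convergence of the coefficient at `(k, 0)`
    have h3 := hc t ht (Fin.snoc (α := fun _ : Fin 3 => ℤ) k 0)
    rw [(EuclideanSpace.equiv (Fin 2) ℂ).toHomeomorph.isEmbedding.tendsto_nhds_iff]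
    refine tendsto_pi_nhds.2 fun j => ?_
    have hj := ((EuclideanSpace.proj (Fin.castSucc j) : EuclideanSpace ℂ (Fin 3) →L[ℂ] ℂ).continuous.tendsto _).comp h3
    have hlim : (EuclideanSpace.proj (Fin.castSucc j) : EuclideanSpace ℂ (Fin 3) →L[ℂ] ℂ)
        (mFourierCoeff (EuclideanSpace.complexify ∘ u t) (Fin.snoc (α := fun _ : Fin 3 => ℤ) k 0)) =
        (EuclideanSpace.equiv (Fin 2) ℂ).toHomeomorph (mFourierCoeff (EuclideanSpace.complexify ∘ Vu t) k) j := by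
      show mFourierCoeff (EuclideanSpace.complexify ∘ u t) (Fin.snoc (α := fun _ : Fin 3 => ℤ) k 0) (Fin.castSucc j) =
        mFourierCoeff (EuclideanSpace.complexify ∘ Vu t) k j
      rw [mFourierCoeff_left_apply hVi hRi k j, ← hueq t]
    have hseq : ∀ n, (EuclideanSpace.proj (Fin.castSucc j) : EuclideanSpace ℂ (Fin 3) →L[ℂ] ℂ)
        (mFourierCoeff (EuclideanSpace.complexify ∘ U n t) (Fin.snoc (α := fun _ : Fin 3 => ℤ) k 0)) =
        (EuclideanSpace.equiv (Fin 2) ℂ).toHomeomorph (mFourierCoeff (EuclideanSpace.complexify ∘ V n t) k) j := by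
      intro n
      show mFourierCoeff (EuclideanSpace.complexify ∘ U n t) (Fin.snoc (α := fun _ : Fin 3 => ℤ) k 0) (Fin.castSucc j) =
        mFourierCoeff (EuclideanSpace.complexify ∘ V n t) k j
      rw [mFourierCoeff_left_apply (hVni n) (hRni n) k j, ← hUeq n t]
    rw [hlim] at hj
    refine hj.congr fun n => ?_
    simp only [Function.comp_apply]
    exact hseq n

end PlanarScheme

end Summit.AnomalousDissipation.AnomalousDissipation.Theorems

end
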